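import Summits.BirchSwinnertonDyer.BirchSwinnertonDyer.Theorems.ErratumRoadFiveNonSurjCornerTateParameter
import Summits.BirchSwinnertonDyer.BirchSwinnertonDyer.Theorems.ErratumRoadFiveNonSurjCornerTateLines
import HarnessLib

/-!
# Route `ErratumRoadFive` (rung K2), crux `NonSurjCorner` (item stmt-BirchSwinnertonDyer-19065):
# THE LOCAL CHARACTERS AT `p` OF A CORNER PAIR — the decomposition group acts on the inertia-fixed
# line `L₀ = E[p]^{I_p}` through the Tate twist sign `χ_γ` (`γ = −c₄/c₆`): `E[p]|_{Γ_{ℚ_p}} ≅ χ_γ ⊕ χ_γ ω`;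
# hence `E(ℚ_p)[p] ≠ 0 ⟺ E` is SPLIT multiplicative at `p`, on the whole corner
# (cell `bsd-stepL`, seat `bsd-stepL-corner5-p2` g3, WIDTH-LEVER lane B «class-level road»;
# `--supports stmt-BirchSwinnertonDyer-19065 --as helper`; file 2 of 2, after `…TateLines`)

WHY THIS FILE. This seat's `…LocalFrame` / `…LocalSplit` / `…TateParameter` give, for `W/ℚ` elliptic,
`p ≠ 2` multiplicative, `p ∤ #ρ̄_{E,p}(Γ_ℚ)` (so at every non-surjective corner pair): two
`Γ_{ℚ_p}`-stable lines `L₀, L₁ ≤ E[p](ℚ̄)`, `L₀ = E[p]^{I_p}`, and the Tate parameter `q ∈ (ℚ_p^×)^p`.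
Here the remaining local datum is pinned: the character `δ₁` of `Γ_{ℚ_p}` on `L₀` IS the quadratic
twist character `χ_γ` of Silverman *ATAEC* Lemma V.5.2 / Cor. V.5.4 (`E` is the twist of `E_q` by the
unramified character of `ℚ_p(√γ)/ℚ_p`, `γ = −c₄/c₆`). Mechanism: under the sign-equivariant `C : E ⥲ E_q`
(`exists_tateParameter_sq_eq_gamma_signEquiv`) the lines go to two distinct stable subgroups `N₀, N₁` of
order `p` of `E_q(ℚ̄_p)`; `N₁` is MOVED by the inertia group (a non-zero point of `L₁` is not in
`L₀ = E[p]^{I}`, and inertia fixes `√γ`), so `N₀` is POINTWISE `Γ_{ℚ_p}`-fixed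
(`forall_smul_eq_of_two_stable_lines`, file `…TateLines`); reading `σ • C(x) = χ_γ(σ) C(σx)` backwards
gives `σ x = χ_γ(σ) x` on `L₀`.

* §3 `exists_stable_lines_local_iff` (the local splitting with the EXACT local-inertia clause, via the
  surjection of local onto global inertia, Neukirch II (9.6)), `exists_stable_lines_sign` (general:
  `p ≠ 2` multiplicative, `p ∤ #G`) and `NonSurjCorner.localCharacter` (corner hypotheses `ClassX11b`,
  `¬Surj`): `t = √γ`, `L₀ = E[p]^{I_𝔐}`, `L₁`, and `res_ι σ • x = χ_γ(σ) • x` on `L₀`.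
* §4 `forall_fixed_eq_zero_of_not_split_of_not_dvd_card` / `NonSurjCorner.forall_fixed_eq_zero_of_not
  _split`: at a NON-split pair no non-zero point of `E[p](ℚ̄)` is fixed by `Γ_{ℚ_p}` — `E(ℚ_p)[p] = 0`;
  with `…TateParameter`'s `exists_fixed_torsion_of_split_of_not_dvd_card`:
  **`NonSurjCorner.exists_fixed_torsion_iff_split` — `E(ℚ_p)[p] ≠ 0 ⟺ E` split multiplicative at `p`**
  (`⟺ a_p = +1 ⟺ p ∣ c_p`), on the whole corner.

HONEST FRAMING: structure theorems about `E/ℚ_p` at a corner pair; nothing here proves the crux, a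
registered stub (`stub_corner5`, `stub_corner7`) or BSD for any class; no census number moves.

References: [SilvermanATAEC1994] V.3.1, Lemma V.5.2, Thm. V.5.3, Cor. V.5.4 (PDF pp. 394–410);
[MochizukiGenEll2010] §3 Lemma 3.2 (i); [Serre1972] §1.11–§1.12 (the characters at a multiplicative
`v ∣ p`), §2.4 Prop. 15; [NeukirchANT1999] II (9.6); tree files `Theorems/ErratumRoadFiveNonSurjCorner
{LocalSplit,TateParameter,TateLines}`, `TateCurve/MultiplicativeTwistUnramifiedProofs`.
-/

set_option linter.dupNamespace false -- `Summit.BirchSwinnertonDyer.BirchSwinnertonDyer` (summit = problem), tree-wide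
set_option autoImplicit false

noncomputable section

open scoped Classical NumberField
open IsDedekindDomain Field WeierstrassCurve

/-! ### §3. The decomposition character on the inertia-fixed line is the Tate twist sign `χ_γ` -/

namespace Summit.BirchSwinnertonDyer.BirchSwinnertonDyer.Theorems.CornerLocal

open WeierstrassCurve NumberField Rat.HeightOneSpectrum
  Literature.NumberTheory.EllipticCurves Literature.NumberTheory.EllipticCurves.TateCurve
  Literature.NumberTheory.GaloisRepresentations SteinWuthrich2013
  Literature.NumberTheory.EllipticCurves.Rank1Residual
  Summit.BirchSwinnertonDyer.Rank1Residual

variable (W : WeierstrassCurve ℚ) [W.IsElliptic] (p : ℕ) [hp : Fact p.Prime]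

/-- **Local splitting on `Γ_{ℚ_p}` with the EXACT inertia clause** (`p ≠ 2` multiplicative,
`p ∤ #ρ̄(Γ_ℚ)`): along `ι : ℚ̄ → ℚ̄_p` with local prime `𝔐`, two cyclic subgroups `L₀, L₁ ≤ E[p](ℚ̄)` of
order `p`, `L₀ ⊓ L₁ = 0`, stable under every `res_ι σ`, and `L₀` is EXACTLY the set of points fixed by
(the restrictions of) the local inertia group `I_𝔐` — the `⇒` direction uses that local inertia SURJECTS
onto the inertia group of `𝔓_{ι,𝔐}` (Neukirch II (9.6), the tree's `exists_mem_inertia_apply_eq_holds`).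
[cite: Serre1972, §1.12 and §2.1 a)] [cite: NeukirchANT1999, Ch. II §9 Prop. (9.6)] -/
theorem exists_stable_lines_local_iff (hp2 : p ≠ 2) (hmult : Mult W p)
    (hG : ¬ p ∣ Nat.card (galoisRepTorsion W p).range)
    {v : HeightOneSpectrum (𝓞 ℚ)} (hv : (primesEquiv v : ℕ) = p)
    (ι : AlgebraicClosure ℚ →ₐ[ℚ] AlgebraicClosure (v.adicCompletion ℚ))
    {𝔐 : Ideal (v.localAbsIntegers)} (h𝔐 : 𝔐 ∈ v.localPrimesAbove) :
    ∃ L₀ L₁ : AddSubgroup (geomTorsion W p),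
      Nat.card L₀ = p ∧ Nat.card L₁ = p ∧ L₀ ⊓ L₁ = ⊥ ∧
      (∀ σ : absoluteGaloisGroup (v.adicCompletion ℚ),
        (∀ x ∈ L₀, resGalOfEmb ι σ • x ∈ L₀) ∧ (∀ x ∈ L₁, resGalOfEmb ι σ • x ∈ L₁)) ∧
      ∀ x : geomTorsion W p,
        (∀ σ ∈ 𝔐.inertia (absoluteGaloisGroup (v.adicCompletion ℚ)), resGalOfEmb ι σ • x = x) ↔
          x ∈ L₀ := by
  obtain ⟨L₀, L₁, h₀, h₁, hinf, hstab, hfix⟩ :=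
    exists_stable_lines_of_mult_of_not_dvd_card W p hp2 hmult hG hv
      (HeightOneSpectrum.primeBelow_mem_primesAbove (ι := ι) h𝔐)
  refine ⟨L₀, L₁, h₀, h₁, hinf,
    fun σ ↦ hstab _ (HeightOneSpectrum.resGalOfEmb_mem_stabilizer_primeBelow v ι h𝔐 σ),
    fun x ↦ ⟨fun hx ↦ (hfix x).mp fun τ hτ ↦ ?_, fun hx σ hσ ↦ ?_⟩⟩
  · -- lift `τ ∈ I_{𝔓_{ι,𝔐}}` to the local inertia group
    obtain ⟨σ, hσI, hσ⟩ :=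
      IsDedekindDomain.HeightOneSpectrum.exists_mem_inertia_apply_eq_holds v ι h𝔐 hτ
    rw [← resGalOfEmb_eq_of_apply_eq ι hσ]
    exact hx σ hσI
  · exact (hfix x).mpr hx _ (HeightOneSpectrum.resGalOfEmb_mem_inertia_primeBelow v ι 𝔐 hσ)

/-- **THE LOCAL CHARACTERS AT `p` (general form: `p ≠ 2` multiplicative, `p ∤ #ρ̄_{E,p}(Γ_ℚ)`).**
Along a `ℚ`-embedding `ι : ℚ̄ → ℚ̄_p` with local prime `𝔐` there are `t ∈ ℚ̄_p` with `t² = γ(W) =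
−c₄/c₆` and two cyclic subgroups `L₀, L₁ ≤ E[p](ℚ̄)` of order `p`, `L₀ ⊓ L₁ = 0`, each stable under
every `res_ι σ`, `σ ∈ Γ_{ℚ_p}`, such that (i) `L₀` is EXACTLY the set of points fixed by the local
inertia group `I_𝔐`, and (ii) on `L₀` every `σ ∈ Γ_{ℚ_p}` acts by the SIGN `χ_γ(σ) = +1` if `σ t = t`,
`−1` otherwise: `res_ι σ • x = χ_γ(σ) • x`. So `E[p]|_{Γ_{ℚ_p}} ≅ χ_γ ⊕ χ_γ ω` with `χ_γ` the unramified
quadratic (or trivial) character of `ℚ_p(√γ)/ℚ_p` (`det = ω`). Proof: see the module docstring.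
[cite: SilvermanATAEC1994, Lemma V.5.2 (c), Thm. V.5.3, Cor. V.5.4 (PDF pp. 406–410)]
[cite: MochizukiGenEll2010, §3 Lemma 3.2 (i)] [cite: Serre1972, §1.11–§1.12] -/
theorem exists_stable_lines_sign (hp2 : p ≠ 2) (hmult : Mult W p)
    (hG : ¬ p ∣ Nat.card (galoisRepTorsion W p).range)
    {v : HeightOneSpectrum (𝓞 ℚ)} (hv : (primesEquiv v : ℕ) = p)
    (ι : AlgebraicClosure ℚ →ₐ[ℚ] AlgebraicClosure (v.adicCompletion ℚ))
    {𝔐 : Ideal (v.localAbsIntegers)} (h𝔐 : 𝔐 ∈ v.localPrimesAbove) :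
    ∃ (t : AlgebraicClosure (v.adicCompletion ℚ)) (L₀ L₁ : AddSubgroup (geomTorsion W p)),
      t ^ 2 = algebraMap (v.adicCompletion ℚ) (AlgebraicClosure (v.adicCompletion ℚ))
        (algebraMap ℚ (v.adicCompletion ℚ) (-(W.c₄ / W.c₆))) ∧
      Nat.card L₀ = p ∧ Nat.card L₁ = p ∧ L₀ ⊓ L₁ = ⊥ ∧
      (∀ σ : absoluteGaloisGroup (v.adicCompletion ℚ),
        (∀ x ∈ L₀, resGalOfEmb ι σ • x ∈ L₀) ∧ (∀ x ∈ L₁, resGalOfEmb ι σ • x ∈ L₁)) ∧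
      (∀ x : geomTorsion W p,
        (∀ σ ∈ 𝔐.inertia (absoluteGaloisGroup (v.adicCompletion ℚ)), resGalOfEmb ι σ • x = x) ↔
          x ∈ L₀) ∧
      ∀ (σ : absoluteGaloisGroup (v.adicCompletion ℚ)), ∀ x ∈ L₀,
        resGalOfEmb ι σ • x =
          (if absoluteGaloisGroup.toAlgEquiv _ σ t = t then (1 : ℤ) else -1) • x := by
  have hpp : p.Prime := hp.out
  -- NB: no `CharZero ℚ_v` INSTANCE in scope (see `…TateParameter`).
  letI := Literature.NumberTheory.GaloisRepresentations.Ultrametric.AdicCompletion.nontriviallyNormedField ℚ v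
  have hmultv : W.HasMultiplicativeReductionAt v := hasMultiplicativeReductionAt_of_mult W p hmult hv
  -- the Tate parameter `q` (V.5.3 (a)) and the sign-equivariant `e : W(ℚ̄_v) ≃+ E_q(ℚ̄_v)` (V.5.2 (c))
  obtain ⟨q, t, e, hq0, hq, -, ht, hsign⟩ := exists_tateParameter_sq_eq_gamma_signEquiv W hmultv
  -- inertia fixes `t` (`ℚ_v(√γ)/ℚ_v` is unramified at a multiplicative place)
  have htI : ∀ τ ∈ 𝔐.inertia (absoluteGaloisGroup (v.adicCompletion ℚ)),
      absoluteGaloisGroup.toAlgEquiv (v.adicCompletion ℚ) τ t = t :=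
    fun τ hτ ↦ toAlgEquiv_eq_of_mem_inertia_of_sq_eq_gamma W hmultv h𝔐 ht hτ
  -- the two lines, with the exact local inertia clause
  obtain ⟨L₀, L₁, h₀, h₁, hinf, hstab, hfix⟩ :=
    exists_stable_lines_local_iff W p hp2 hmult hG hv ι h𝔐
  refine ⟨t, L₀, L₁, ht, h₀, h₁, hinf, hstab, hfix, ?_⟩
  -- the transport `f = e ∘ ι_*`, injective and sign-equivariant
  set f : geomTorsion W p →+ geomPoints (tateCurve q) :=
    e.toAddMonoidHom.comp ((pointsMapOfEmb W ι).comp (geomTorsion W (p : ℤ)).subtype) with hf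
  have hfapply : ∀ x : geomTorsion W p, f x = e (pointsMapOfEmb W ι (x : geomPoints W)) := fun _ ↦ rfl
  have hfinj : Function.Injective f := by
    intro x y hxy
    rw [hfapply, hfapply] at hxy
    exact Subtype.ext (pointsMapOfEmb_injective W ι (e.injective hxy))
  have hfsmul : ∀ (σ : absoluteGaloisGroup (v.adicCompletion ℚ)) (x : geomTorsion W p),
      σ • f x = (if absoluteGaloisGroup.toAlgEquiv _ σ t = t then (1 : ℤ) else -1) •
        f (resGalOfEmb ι σ • x) := by
    intro σ x
    rw [hfapply, hfapply, hsign σ, AddSubgroup.torsionBy.coe_smul, pointsMapOfEmb_smul]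
  have hN : ∀ L : AddSubgroup (geomTorsion W p),
      (∀ σ : absoluteGaloisGroup (v.adicCompletion ℚ), ∀ x ∈ L, resGalOfEmb ι σ • x ∈ L) →
      ∀ σ : absoluteGaloisGroup (v.adicCompletion ℚ), ∀ z ∈ L.map f, σ • z ∈ L.map f := by
    intro L hL σ z hz
    obtain ⟨x, hx, rfl⟩ := AddSubgroup.mem_map.mp hz
    rw [hfsmul]
    exact AddSubgroup.zsmul_mem _ (AddSubgroup.mem_map_of_mem f (hL σ x hx)) _
  have hN₀ : Nat.card (L₀.map f) = p := by rw [AddSubgroup.card_map_of_injective hfinj, h₀]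
  have hN₁ : Nat.card (L₁.map f) = p := by rw [AddSubgroup.card_map_of_injective hfinj, h₁]
  have hne : L₀.map f ≠ L₁.map f := by
    intro hEq
    have hL : L₀ = L₁ := AddSubgroup.map_injective hfinj hEq
    rw [hL, inf_idem] at hinf
    rw [hinf, AddSubgroup.card_bot] at h₁
    exact hpp.one_lt.ne' h₁.symm
  -- inertia moves some point of `f(L₁)` (a non-zero `x ∈ L₁` is not in `L₀ = E[p]^{I}`)
  have hI₁ : ∃ σ : absoluteGaloisGroup (v.adicCompletion ℚ), ∃ z ∈ L₁.map f, σ • z ≠ z := by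
    haveI : Finite L₁ := Nat.finite_of_card_ne_zero (by rw [h₁]; exact hpp.ne_zero)
    obtain ⟨⟨x, hx⟩, hx0⟩ : ∃ y : L₁, y ≠ 0 := by
      by_contra hall
      push Not at hall
      haveI : Subsingleton L₁ := ⟨fun a b ↦ by rw [hall a, hall b]⟩
      have : Nat.card L₁ ≤ 1 := Finite.card_le_one_iff_subsingleton.mpr inferInstance
      rw [h₁] at this
      exact absurd this (not_le.mpr hpp.one_lt)
    have hx0' : x ≠ 0 := fun h ↦ hx0 (Subtype.ext h)
    have hxL₀ : x ∉ L₀ := by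
      intro h
      have : x ∈ L₀ ⊓ L₁ := ⟨h, hx⟩
      rw [hinf, AddSubgroup.mem_bot] at this
      exact hx0' this
    have hmoved : ¬ ∀ σ ∈ 𝔐.inertia (absoluteGaloisGroup (v.adicCompletion ℚ)),
        resGalOfEmb ι σ • x = x := fun h ↦ hxL₀ ((hfix x).mp h)
    push Not at hmoved
    obtain ⟨σ, hσ, hσx⟩ := hmoved
    refine ⟨σ, f x, AddSubgroup.mem_map_of_mem f hx, fun h ↦ hσx (hfinj ?_)⟩
    rw [hfsmul, if_pos (htI σ hσ), one_zsmul] at h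
    exact h
  -- the Tate-curve rigidity: `Γ_{ℚ_v}` fixes `f(L₀)` pointwise
  have hfixall := @forall_smul_eq_of_two_stable_lines (v.adicCompletion ℚ) _ _ _
    (charZero_adicCompletion' ℚ v) q hq0 hq p hpp (L₀.map f) (L₁.map f) hN₀ hN₁ hne
    (hN L₀ fun σ ↦ (hstab σ).1) (hN L₁ fun σ ↦ (hstab σ).2) hI₁
  -- read back through the sign-equivariance
  intro σ x hx
  have h := hfixall σ (f x) (AddSubgroup.mem_map_of_mem f hx)
  rw [hfsmul] at h
  apply hfinj
  split_ifs at h with hσt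
  · rw [if_pos hσt, one_zsmul]
    rw [one_zsmul] at h
    exact h
  · rw [if_neg hσt, neg_one_zsmul, map_neg]
    rw [neg_one_zsmul, neg_eq_iff_eq_neg] at h
    exact h

/-! ### §4. Consequences on the corner: `E(ℚ_p)[p] ≠ 0 ⟺` split multiplicative at `p` -/

/-- **At a NON-split multiplicative place, no non-zero `p`-torsion point is `Γ_{ℚ_p}`-fixed**
(`p ≠ 2`, `p ∤ #ρ̄(Γ_ℚ)`): if `W` is multiplicative but not split multiplicative at the place `v` of `p`,
every `x ∈ E[p](ℚ̄)` fixed by all `res_ι σ`, `σ ∈ Γ_{ℚ_p}`, is `O` — `E(ℚ_p)[p] = 0`. (A fixed `x` lies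
in `L₀` (inertia); some `σ` moves `√γ` (`exists_toAlgEquiv_ne_of_not_split`) and acts on `L₀` by `−1`;
`x = −x` with `p` odd forces `x = 0`.) [cite: SilvermanATAEC1994, Thm. V.5.3 (b), Cor. V.5.4 (PDF pp. 407–410)]
[cite: MochizukiGenEll2010, §3 Lemma 3.2 (i)] -/
theorem forall_fixed_eq_zero_of_not_split_of_not_dvd_card (hp2 : p ≠ 2) (hmult : Mult W p)
    (hG : ¬ p ∣ Nat.card (galoisRepTorsion W p).range)
    {v : HeightOneSpectrum (𝓞 ℚ)} (hv : (primesEquiv v : ℕ) = p)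
    (hns : ¬ W.HasSplitMultiplicativeReductionAt v)
    (ι : AlgebraicClosure ℚ →ₐ[ℚ] AlgebraicClosure (v.adicCompletion ℚ))
    (x : geomTorsion W p)
    (hx : ∀ σ : absoluteGaloisGroup (v.adicCompletion ℚ), resGalOfEmb ι σ • x = x) : x = 0 := by
  have hpp : p.Prime := hp.out
  obtain ⟨𝔐, h𝔐⟩ := v.localPrimesAbove_nonempty
  obtain ⟨t, L₀, L₁, ht, h₀, -, -, -, hfix, hsignL⟩ :=
    exists_stable_lines_sign W p hp2 hmult hG hv ι h𝔐
  have hmultv : W.HasMultiplicativeReductionAt v := hasMultiplicativeReductionAt_of_mult W p hmult hv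
  obtain ⟨σ, hσt⟩ := exists_toAlgEquiv_ne_of_not_split W v hmultv hns ht
  have hxL₀ : x ∈ L₀ := (hfix x).mp fun τ _ ↦ hx τ
  have hneg : x = -x := by
    have h := hsignL σ x hxL₀
    rw [hx σ, if_neg hσt, neg_one_zsmul] at h
    exact h
  -- `2 • x = 0` and `p • x = 0` with `p` odd
  have h2 : 2 • x = 0 := by rw [two_nsmul]; nth_rw 2 [hneg]; exact add_neg_cancel x
  haveI : Finite L₀ := Nat.finite_of_card_ne_zero (by rw [h₀]; exact hpp.ne_zero)
  have hpx : p • x = 0 := by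
    have h := card_nsmul_eq_zero' (x := (⟨x, hxL₀⟩ : L₀))
    rw [h₀] at h
    exact congrArg Subtype.val h
  have hdvd2 : addOrderOf x ∣ 2 := addOrderOf_dvd_of_nsmul_eq_zero h2
  have hdvdp : addOrderOf x ∣ p := addOrderOf_dvd_of_nsmul_eq_zero hpx
  have hcop : Nat.Coprime 2 p := (Nat.coprime_primes Nat.prime_two hpp).mpr (Ne.symm hp2)
  have h1 : addOrderOf x = 1 := Nat.eq_one_of_dvd_coprimes hcop hdvd2 hdvdp
  exact AddMonoid.addOrderOf_eq_one_iff.mp h1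

/-- **THE LOCAL CHARACTERS OF A CORNER PAIR** (crux `NonSurjCorner`, both stubs, every `5S4` / `5Ns` /
`N_s(7)` pair, any odd `p`): for `(E, p)` in class X11b with `ρ̄_{E,p}` NOT onto, along `ι : ℚ̄ → ℚ̄_p`
with local prime `𝔐`: `t = √γ`, lines `L₀ = E[p]^{I_𝔐}`, `L₁`, and `res_ι σ • x = χ_γ(σ) • x` on `L₀` —
`E[p]|_{Γ_{ℚ_p}} ≅ χ_γ ⊕ χ_γ ω`, `χ_γ` the character of `ℚ_p(√(−c₄/c₆))/ℚ_p` (trivial iff split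
multiplicative: then the local type is the «anomalous» `{1, ω}`). Nothing about BSD is claimed.
[cite: SilvermanATAEC1994, Lemma V.5.2 (c), Thm. V.5.3, Cor. V.5.4 (PDF pp. 406–410)]
[cite: MochizukiGenEll2010, §3 Lemma 3.2 (i)] [cite: Serre1972, §1.11–§1.12, §2.4 Prop. 15] -/
theorem NonSurjCorner.localCharacter [W.IsGloballyMinimal] (hX : ClassX11b W p) (hns : ¬ Surj W p)
    {v : HeightOneSpectrum (𝓞 ℚ)} (hv : (primesEquiv v : ℕ) = p)
    (ι : AlgebraicClosure ℚ →ₐ[ℚ] AlgebraicClosure (v.adicCompletion ℚ))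
    {𝔐 : Ideal (v.localAbsIntegers)} (h𝔐 : 𝔐 ∈ v.localPrimesAbove) :
    ∃ (t : AlgebraicClosure (v.adicCompletion ℚ)) (L₀ L₁ : AddSubgroup (geomTorsion W p)),
      t ^ 2 = algebraMap (v.adicCompletion ℚ) (AlgebraicClosure (v.adicCompletion ℚ))
        (algebraMap ℚ (v.adicCompletion ℚ) (-(W.c₄ / W.c₆))) ∧
      Nat.card L₀ = p ∧ Nat.card L₁ = p ∧ L₀ ⊓ L₁ = ⊥ ∧
      (∀ σ : absoluteGaloisGroup (v.adicCompletion ℚ),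
        (∀ x ∈ L₀, resGalOfEmb ι σ • x ∈ L₀) ∧ (∀ x ∈ L₁, resGalOfEmb ι σ • x ∈ L₁)) ∧
      (∀ x : geomTorsion W p,
        (∀ σ ∈ 𝔐.inertia (absoluteGaloisGroup (v.adicCompletion ℚ)), resGalOfEmb ι σ • x = x) ↔
          x ∈ L₀) ∧
      ∀ (σ : absoluteGaloisGroup (v.adicCompletion ℚ)), ∀ x ∈ L₀,
        resGalOfEmb ι σ • x =
          (if absoluteGaloisGroup.toAlgEquiv _ σ t = t then (1 : ℤ) else -1) • x := by
  obtain ⟨-, hp2, hmult, hirr⟩ := hX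
  obtain ⟨e, Φ, he, -⟩ := exists_frame_galoisRepTorsion_rat W p
  have hG : ¬ p ∣ Nat.card (galoisRepTorsion W p).range := by
    rw [← card_map_range_galoisRepTorsion W p Φ]
    exact not_dvd_card_of_not_hasSurjectiveModNGaloisRep W p Φ e he hirr hns
  exact exists_stable_lines_sign W p hp2 hmult hG hv ι h𝔐

/-- **NON-SPLIT CORNER PAIRS HAVE `E(ℚ_p)[p] = 0`**: for `(E, p)` in class X11b with `ρ̄_{E,p}` NOT onto
and `E` NOT split multiplicative at the place `v` of `p` (`a_p = −1`: 9 of the 15 Cartan pairs of record,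
memo CORNER5-P2-G2 §1b), no non-zero `x ∈ E[p](ℚ̄)` is fixed by all `res_ι σ`, `σ ∈ Γ_{ℚ_p}`.
Nothing about BSD is claimed. [cite: SilvermanATAEC1994, Thm. V.5.3 (b), Cor. V.5.4 (PDF pp. 407–410)]
[cite: MochizukiGenEll2010, §3 Lemma 3.2 (i)] [cite: Serre1972, §1.12, §2.4 Prop. 15] -/
theorem NonSurjCorner.forall_fixed_eq_zero_of_not_split [W.IsGloballyMinimal] (hX : ClassX11b W p)
    (hns : ¬ Surj W p) {v : HeightOneSpectrum (𝓞 ℚ)} (hv : (primesEquiv v : ℕ) = p)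
    (hnsplit : ¬ W.HasSplitMultiplicativeReductionAt v)
    (ι : AlgebraicClosure ℚ →ₐ[ℚ] AlgebraicClosure (v.adicCompletion ℚ))
    (x : geomTorsion W p)
    (hx : ∀ σ : absoluteGaloisGroup (v.adicCompletion ℚ), resGalOfEmb ι σ • x = x) : x = 0 := by
  obtain ⟨-, hp2, hmult, hirr⟩ := hX
  obtain ⟨e, Φ, he, -⟩ := exists_frame_galoisRepTorsion_rat W p
  have hG : ¬ p ∣ Nat.card (galoisRepTorsion W p).range := by
    rw [← card_map_range_galoisRepTorsion W p Φ]
    exact not_dvd_card_of_not_hasSurjectiveModNGaloisRep W p Φ e he hirr hns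
  exact forall_fixed_eq_zero_of_not_split_of_not_dvd_card W p hp2 hmult hG hv hnsplit ι x hx

/-- **`E(ℚ_p)[p] ≠ 0 ⟺ E` IS SPLIT MULTIPLICATIVE AT `p`, ON THE WHOLE CORNER**: for `(E, p)` in class
X11b with `ρ̄_{E,p}` NOT onto and `ι : ℚ̄ → ℚ̄_p`, a non-zero point of `E[p](ℚ̄)` fixed by the whole local
Galois group exists iff `E` has split multiplicative reduction at the place of `p` (`⇐`:
`NonSurjCorner.exists_fixed_torsion_of_split`, file `…TateParameter`; `⇒`: this file). Equivalently
(`a_p = +1`, `p ∣ c_p`): the «anomalous» sub-corner. Nothing about BSD is claimed.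
[cite: SilvermanATAEC1994, Thm. V.3.1, Thm. V.5.3, Cor. V.5.4 (PDF pp. 394–410)]
[cite: MochizukiGenEll2010, §3 Lemma 3.2 (i)] [cite: Serre1972, §1.12, §2.4 Prop. 15] -/
theorem NonSurjCorner.exists_fixed_torsion_iff_split [W.IsGloballyMinimal] (hX : ClassX11b W p)
    (hns : ¬ Surj W p) {v : HeightOneSpectrum (𝓞 ℚ)} (hv : (primesEquiv v : ℕ) = p)
    (ι : AlgebraicClosure ℚ →ₐ[ℚ] AlgebraicClosure (v.adicCompletion ℚ)) :
    (∃ x : geomTorsion W p, x ≠ 0 ∧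
        ∀ σ : absoluteGaloisGroup (v.adicCompletion ℚ), resGalOfEmb ι σ • x = x) ↔
      W.HasSplitMultiplicativeReductionAt v := by
  obtain ⟨-, hp2, hmult, hirr⟩ := hX
  obtain ⟨e, Φ, he, -⟩ := exists_frame_galoisRepTorsion_rat W p
  have hG : ¬ p ∣ Nat.card (galoisRepTorsion W p).range := by
    rw [← card_map_range_galoisRepTorsion W p Φ]
    exact not_dvd_card_of_not_hasSurjectiveModNGaloisRep W p Φ e he hirr hns
  refine ⟨fun ⟨x, hx0, hx⟩ ↦ ?_,
    fun hsplit ↦ exists_fixed_torsion_of_split_of_not_dvd_card W p hp2 hv hsplit hG ι⟩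
  by_contra hnsplit
  exact hx0 (forall_fixed_eq_zero_of_not_split_of_not_dvd_card W p hp2 hmult hG hv hnsplit ι x hx)

end Summit.BirchSwinnertonDyer.BirchSwinnertonDyer.Theorems.CornerLocal

end
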